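import Summits.AtomisticToContinuum.BoseEinsteinCondensation.Theorems.PuffFloor.Negative.PuffFloorFalseForNearMinimisers
import HarnessLib

/-!
# The class-blind quadratic floor for near-minimisers is false (negative lemma for crux `HardCoreExtension`, stmt-AtomisticToContinuum-11786)

Standing adversary of crux `HardCoreExtension` (route `BECConjugateDomination`), gen 3. The
crux-ideate round-1 line `second-moment-floor-class-blind` (ideator 3, merged by the triage panel
with `third-law-current-floor`) replaces the route's `PuffFloor` by a CLASS-BLIND floor on the static
structure factor stated for NEAR-minimisers — near-minimisers because for hard cores there is no
exact `C¹` minimiser to speak about. Verbatim (`Cruxes/HardCoreExtension/SketchIdeator3.lean ::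
Ideator3.QuadraticFloor`, restated here as `QuadraticFloorNearMin`):
for every repulsive finite-range `v` there are `C ≥ 0`, `ρ₀ > 0` with: for `0 < ρ < ρ₀`, all large
`N = n + 1` and SOME slack `δ > 0`, every real non-negative `δ`-near-minimiser on the torus of side
`(N/ρ)^{1/3}` has `S_m ≥ kn m² / (kn m² + Cρ)` for ALL modes `m ≠ 0`.

* `quadraticFloorNearMin_false : ¬ QuadraticFloorNearMin`. Witness: the FREE gas `v ≡ 0`
  (admissible; `E₀^per = 0`), any density, every `N ≥ 2`, every slack `δ > 0`: the anti-correlated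
  state `Ψ_ε ∝ (1 - ε(|ρ̂_m|² - N))^{1/2}` of the `PuffFloor` disprover
  (`PuffFloor.Negative.witnessState`, `S_m(Ψ_ε) = 1 - εn`, `periodicEnergy 0 Ψ_ε ≤ 2ε²N³|k|²`) at a
  HIGH mode `k = (2π/L)(j,0,0)`, `k² > Cρ/(εn)`, `ε = η/N²`: its energy is `≤ η(8Cρ + 16π²/L²) < δ`
  for `η` small while `S_m = 1 - εn < k²/(k² + Cρ)`. The deficit the floor tolerates at mode `k`
  is `Cρ/(k² + Cρ) = O(k⁻²)` and a density modulation of that depth costs `O(deficit² · k²) =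
  O(k⁻²) → 0`: NO near-minimiser floor `f(kn m) ≤ S m` over all modes with `(1 - f(k))·k → 0`
  survives (the route's `PuffFloor` shape `k/√(k²+Cρ)` included — that is the sibling theorem
  `PuffFloor.Negative.puffFloor_false_for_nearMinimisers`; the quadratic shape dies the same way).
* REPAIR (typed in the crux work file `Cruxes/HardCoreExtension/Disproof.lean`, §10): cap the
  floor, `min (1/2) (kn m²/(kn m² + Cρ)) ≤ S m` — the witness family cannot dip below `1/2`
  (positivity of `1 - ε·pairCorr` forces `εn ≤ 1/(2N)`), and at fixed `(N, L)` a dip of fixed size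
  costs the spectral gap; or quantify over exact minimisers (vacuous on hard cores) / a finite mode
  window chosen before `δ`.

No Theses statement is asserted positively. All `[folklore]`.
-/

noncomputable section

namespace Summit.AtomisticToContinuum.BoseEinsteinCondensation.Theorems.HardCoreExtension.Negative

open Literature.MathematicalPhysics.QuantumManyBody.BoseGas MeasureTheory Filter
open Summit.AtomisticToContinuum.BoseEinsteinCondensation.Theorems.PuffFloor.Negative
open scoped ENNReal NNReal

/-- Verbatim copy of `Cruxes/HardCoreExtension/SketchIdeator3.lean :: Ideator3.QuadraticFloor`
(card `second-moment-floor-class-blind`, the crux-strength stub replacing `PuffFloor`): a class-blind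
quadratic floor on the structure factor of every real non-negative NEAR-minimiser, at ALL modes. -/
def QuadraticFloorNearMin : Prop :=
  ∀ v : ℝ → ℝ≥0∞, IsRepulsiveFiniteRange v →
    ∃ C : ℝ, 0 ≤ C ∧ ∃ ρ₀ : ℝ, 0 < ρ₀ ∧ ∀ ρ : ℝ, 0 < ρ → ρ < ρ₀ →
      ∀ᶠ n : ℕ in atTop, ∃ δ : ℝ≥0∞, 0 < δ ∧
        ∀ Ψ : PeriodicTrialState (n + 1) (sideLength ρ (n + 1)),
          (let L : ℝ := sideLength ρ (n + 1)
           let S : (Fin 3 → ℤ) → ℝ := fun m => ((n : ℝ) + 1)⁻¹ *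
             ∫ X in cellN (n + 1) L, ‖∑ j : Fin (n + 1), cellWave L m (X j)‖ ^ 2 * ‖Ψ.ψ X‖ ^ 2
           let kn : (Fin 3 → ℤ) → ℝ := fun m => ‖((2 * Real.pi / L) • latticeVec 1 m)‖
           periodicEnergy v Ψ ≤ periodicGroundStateEnergy v (n + 1) L + δ →
           periodicEnergy v Ψ ≠ ⊤ →
           (∀ X, Ψ.ψ X = (‖Ψ.ψ X‖ : ℂ)) →
           ∀ m : Fin 3 → ℤ, m ≠ 0 → kn m ^ 2 / (kn m ^ 2 + C * ρ) ≤ S m)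

/-- The algebra of the contradiction for the quadratic floor: `k²/(k²+Cρ) ≤ 1 - δ` and
`Cρ < k²δ` are incompatible (`0 < δ`, `0 ≤ Cρ`, `0 < k`). [folklore] -/
theorem quadraticFloor_contradiction {k δ Cρ : ℝ} (hk : 0 < k) (hδ0 : 0 < δ) (hCρ0 : 0 ≤ Cρ)
    (hCρ : Cρ < k ^ 2 * δ) (h : k ^ 2 / (k ^ 2 + Cρ) ≤ 1 - δ) : False := by
  have hpos : 0 < k ^ 2 + Cρ := by positivity
  rw [div_le_iff₀ hpos] at h
  -- `k² ≤ (1-δ)(k²+Cρ)` gives `δ k² ≤ (1-δ) Cρ ≤ Cρ < k² δ`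
  have h1 : (1 - δ) * Cρ ≤ Cρ := by nlinarith
  nlinarith

/-- **The class-blind quadratic floor for near-minimisers is FALSE** (already for the free gas, at
every density, every `N ≥ 2` and every slack). See the module docstring for the witness and the
repair. [folklore] -/
theorem quadraticFloorNearMin_false : ¬ QuadraticFloorNearMin := by
  intro h
  obtain ⟨h1, -, -, -⟩ := smoothClass_zero
  obtain ⟨C, hC, ρ₀, hρ₀, h⟩ := h 0 h1
  set ρ : ℝ := ρ₀ / 2 with hρdef
  have hρ : 0 < ρ := by positivity
  have hev := h ρ hρ (by rw [hρdef]; linarith)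
  rw [Filter.eventually_atTop] at hev
  obtain ⟨n₀, hn₀⟩ := hev
  set n : ℕ := max n₀ 1 with hndef
  have h1n : 1 ≤ n := le_max_right _ _
  have hn' : (1 : ℝ) ≤ n := by exact_mod_cast h1n
  obtain ⟨δ', hδ'0, key⟩ := hn₀ n (le_max_left _ _)
  set L : ℝ := sideLength ρ (n + 1) with hLdef
  have hL : 0 < L := Real.rpow_pos_of_pos (by positivity) _
  clear_value L n ρ
  -- a real energy budget `δr` below `δ'`
  obtain ⟨δr, hδr, hδr'⟩ : ∃ δr : ℝ, 0 < δr ∧ ENNReal.ofReal δr ≤ δ' := by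
    rcases eq_or_ne δ' ⊤ with htop | htop
    · exact ⟨1, one_pos, htop ▸ le_top⟩
    · exact ⟨δ'.toReal, ENNReal.toReal_pos hδ'0.ne' htop, ENNReal.ofReal_toReal_le⟩
  -- the small parameter `η` and the amplitude `ε = η / N²`
  obtain ⟨c₀, hc₀⟩ : ∃ c₀ : ℝ, c₀ = 2 * Real.pi / L := ⟨_, rfl⟩
  have hc₀0 : 0 < c₀ := by rw [hc₀]; positivity
  obtain ⟨A, hA⟩ : ∃ A : ℝ, A = 8 * C * ρ + 4 * c₀ ^ 2 := ⟨_, rfl⟩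
  have hA0 : 0 < A := by rw [hA]; positivity
  obtain ⟨η, hηdef⟩ : ∃ η : ℝ, η = min (1 / 2) (δr / (2 * A)) := ⟨_, rfl⟩
  have hη0 : 0 < η := by rw [hηdef]; exact lt_min (by norm_num) (by positivity)
  have hη1 : η ≤ 1 / 2 := by rw [hηdef]; exact min_le_left _ _
  have hηA : η * A ≤ δr / 2 := by
    have : η ≤ δr / (2 * A) := by rw [hηdef]; exact min_le_right _ _
    rw [le_div_iff₀ (by positivity)] at this
    linarith
  obtain ⟨ε, hεdef⟩ : ∃ ε : ℝ, ε = η / ((n : ℝ) + 1) ^ 2 := ⟨_, rfl⟩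
  have hε0 : 0 ≤ ε := by rw [hεdef]; positivity
  have hεN : ε * ((n : ℝ) + 1) ^ 2 = η := by rw [hεdef]; field_simp
  have hεa : ε * ((((n + 1 : ℕ) : ℝ)) ^ 2 - ((n + 1 : ℕ) : ℝ)) ≤ 1 / 2 := by
    push_cast
    have e : ε * (((n : ℝ) + 1) ^ 2 - ((n : ℝ) + 1)) =
        ε * ((n : ℝ) + 1) ^ 2 - ε * ((n : ℝ) + 1) := by ring
    have hpos : 0 ≤ ε * ((n : ℝ) + 1) := by positivity
    rw [e, hεN]
    linarith
  -- the deficit `δ = ε n` of the witness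
  obtain ⟨δ, hδdef⟩ : ∃ δ : ℝ, δ = ε * n := ⟨_, rfl⟩
  have hδ0 : 0 < δ := by
    rw [hδdef]; exact mul_pos (by rw [hεdef]; positivity) (by positivity)
  -- the mode: `j = ⌊√K/c₀⌋ + 1`, `K = Cρ/δ`, `k = c₀ j`
  obtain ⟨K, hK⟩ : ∃ K : ℝ, K = C * ρ / δ := ⟨_, rfl⟩
  have hK0 : 0 ≤ K := by rw [hK]; positivity
  obtain ⟨j, hj⟩ : ∃ j : ℕ, j = ⌊Real.sqrt K / c₀⌋₊ + 1 := ⟨_, rfl⟩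
  have hj0 : 0 < j := by rw [hj]; exact Nat.succ_pos _
  obtain ⟨m, hmdef⟩ : ∃ m : Fin 3 → ℤ, m = Pi.single (0 : Fin 3) ((j : ℕ) : ℤ) := ⟨_, rfl⟩
  have hm : m ≠ 0 := by
    intro h0
    have := congr_fun h0 0
    rw [hmdef, Pi.single_eq_same, Pi.zero_apply] at this
    exact hj0.ne' (by exact_mod_cast this)
  have hkn : ‖((2 * Real.pi / L) • latticeVec 1 m)‖ = c₀ * j := by
    rw [hmdef, hc₀]
    exact norm_smul_latticeVec_single (by positivity) j
  obtain ⟨k, hkdef⟩ : ∃ k : ℝ, k = c₀ * j := ⟨_, rfl⟩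
  rw [← hkdef] at hkn
  have hjlow : Real.sqrt K / c₀ < j := by rw [hj]; push_cast; exact Nat.lt_floor_add_one _
  have hjup : (j : ℝ) ≤ Real.sqrt K / c₀ + 1 := by
    rw [hj]; push_cast; gcongr; exact Nat.floor_le (by positivity)
  have hklow : Real.sqrt K < k := by
    rw [div_lt_iff₀ hc₀0] at hjlow; rw [hkdef]; linarith
  have hk0 : 0 < k := lt_of_le_of_lt (Real.sqrt_nonneg K) hklow
  have hkup : k ≤ Real.sqrt K + c₀ := by
    have := mul_le_mul_of_nonneg_left hjup hc₀0.le
    rw [hkdef]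
    calc c₀ * j ≤ c₀ * (Real.sqrt K / c₀ + 1) := this
      _ = Real.sqrt K + c₀ := by field_simp
  have hsqK : Real.sqrt K ^ 2 = K := Real.sq_sqrt hK0
  have hK_lt : K < k ^ 2 := by
    rw [← hsqK]
    exact pow_lt_pow_left₀ hklow (Real.sqrt_nonneg K) two_ne_zero
  have hCρ : C * ρ < k ^ 2 * δ := by
    have : C * ρ = K * δ := by rw [hK]; field_simp
    rw [this]
    exact mul_lt_mul_of_pos_right hK_lt hδ0
  have hk2 : k ^ 2 ≤ 2 * K + 2 * c₀ ^ 2 := by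
    have h0 := sq_le_two_sq_add_two_sq hk0.le hkup
    rwa [hsqK] at h0
  -- real-arithmetic energy budget: `2 ε² N³ k² ≤ η A ≤ δr`
  have hEreal : 2 * ε ^ 2 * ((n : ℝ) + 1) ^ 3 * k ^ 2 ≤ δr := by
    have hx0 : 0 ≤ 2 * ε ^ 2 * ((n : ℝ) + 1) ^ 3 := by positivity
    have h1 : 2 * ε ^ 2 * ((n : ℝ) + 1) ^ 3 * k ^ 2 ≤
        2 * ε ^ 2 * ((n : ℝ) + 1) ^ 3 * (2 * K) + 2 * ε ^ 2 * ((n : ℝ) + 1) ^ 3 * (2 * c₀ ^ 2) := by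
      rw [← mul_add]; exact mul_le_mul_of_nonneg_left hk2 hx0
    have h2 : 2 * ε ^ 2 * ((n : ℝ) + 1) ^ 3 * (2 * K) ≤ 8 * η * (C * ρ) := by
      have he : 2 * ε ^ 2 * ((n : ℝ) + 1) ^ 3 * (2 * K) =
          4 * η * (C * ρ) * (((n : ℝ) + 1) / n) := by
        rw [hK, hδdef, ← hεN]
        field_simp
        ring
      rw [he]
      have h3 : ((n : ℝ) + 1) / n ≤ 2 := by rw [div_le_iff₀ (by positivity)]; linarith
      have h4 : 0 ≤ 4 * η * (C * ρ) := by positivity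
      calc 4 * η * (C * ρ) * (((n : ℝ) + 1) / n) ≤ 4 * η * (C * ρ) * 2 :=
            mul_le_mul_of_nonneg_left h3 h4
        _ = 8 * η * (C * ρ) := by ring
    have h3 : 2 * ε ^ 2 * ((n : ℝ) + 1) ^ 3 * (2 * c₀ ^ 2) ≤ 4 * η * c₀ ^ 2 := by
      have he : 2 * ε ^ 2 * ((n : ℝ) + 1) ^ 3 * (2 * c₀ ^ 2) =
          4 * c₀ ^ 2 * (η * (η / ((n : ℝ) + 1))) := by
        rw [← hεN]; field_simp; ring
      rw [he]
      have h5 : η / ((n : ℝ) + 1) ≤ 1 := by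
        rw [div_le_one (by positivity)]; linarith
      have h6 : η * (η / ((n : ℝ) + 1)) ≤ η := by
        calc η * (η / ((n : ℝ) + 1)) ≤ η * 1 := mul_le_mul_of_nonneg_left h5 hη0.le
          _ = η := mul_one η
      calc 4 * c₀ ^ 2 * (η * (η / ((n : ℝ) + 1))) ≤ 4 * c₀ ^ 2 * η :=
            mul_le_mul_of_nonneg_left h6 (by positivity)
        _ = 4 * η * c₀ ^ 2 := by ring
    have h7 : 8 * η * (C * ρ) + 4 * η * c₀ ^ 2 = η * A := by rw [hA]; ring
    linarith
  -- the witness and its energy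
  have hE : periodicEnergy (0 : ℝ → ℝ≥0∞) (witnessState hε0 hεa hL hm) ≤
      periodicGroundStateEnergy (0 : ℝ → ℝ≥0∞) (n + 1) L + δ' := by
    rw [periodicGroundStateEnergy_zero_eq_zero (n + 1) hL, zero_add]
    refine (periodicEnergy_witnessState_le hε0 hεa hL hm).trans (le_trans ?_ hδr')
    refine ENNReal.ofReal_le_ofReal ?_
    rw [hkn]
    push_cast
    exact hEreal
  -- evaluate the near-minimiser inequality on the witness (no `Ψ ≠ 0` hypothesis here)
  have hw := key (witnessState hε0 hεa hL hm) hE (periodicEnergy_zero_ne_top _)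
    (witnessState_real hε0 hεa hL hm) m hm
  dsimp only at hw
  rw [structureFactor_witnessState_succ' hL n hε0 hεa hm, hkn, ← hδdef] at hw
  -- `k²/(k² + Cρ) ≤ 1 - δ` contradicts `Cρ < k²δ`
  exact quadraticFloor_contradiction hk0 hδ0 (by positivity) hCρ hw

/-- The same junk kills every near-minimiser floor whose tolerated deficit is `o(1/k)`: for the
free gas, at every `N = n + 1 ≥ 2`, `L > 0`, every mode `m ≠ 0` and every amplitude
`0 ≤ ε ≤ 1/(2N²)` there is a real, pointwise positive periodic trial state with
`S_m = 1 - εn` EXACTLY and `periodicEnergy 0 ≤ 2ε²N³(kn m)²` (so a dip of depth `d` at mode `k`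
costs `≤ 2d²N³k²/n²`). Packaged form of the `PuffFloor` disprover's witness for re-use by the
lines of this crux. [folklore] -/
theorem exists_freeState_structureFactor_eq (n : ℕ) {L : ℝ} (hL : 0 < L) {m : Fin 3 → ℤ}
    (hm : m ≠ 0) {ε : ℝ} (hε : 0 ≤ ε) (hε' : ε * (((n : ℝ) + 1) ^ 2) ≤ 1 / 2) :
    ∃ Ψ : PeriodicTrialState (n + 1) L,
      (∀ X, Ψ.ψ X = (‖Ψ.ψ X‖ : ℂ)) ∧ (∀ X, Ψ.ψ X ≠ 0) ∧
      periodicEnergy (0 : ℝ → ℝ≥0∞) Ψ ≤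
        ENNReal.ofReal (2 * ε ^ 2 * ((n : ℝ) + 1) ^ 3 * ‖((2 * Real.pi / L) • latticeVec 1 m)‖ ^ 2) ∧
      ((n : ℝ) + 1)⁻¹ * ∫ X in cellN (n + 1) L,
          ‖∑ j : Fin (n + 1), cellWave L m (X j)‖ ^ 2 * ‖Ψ.ψ X‖ ^ 2 = 1 - ε * n := by
  have hεa : ε * ((((n + 1 : ℕ) : ℝ)) ^ 2 - ((n + 1 : ℕ) : ℝ)) ≤ 1 / 2 := by
    push_cast
    have hpos : 0 ≤ ε * ((n : ℝ) + 1) := by positivity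
    nlinarith
  refine ⟨witnessState hε hεa hL hm, witnessState_real hε hεa hL hm, witnessState_ne_zero hε hεa hL hm,
    ?_, structureFactor_witnessState_succ' hL n hε hεa hm⟩
  have h := periodicEnergy_witnessState_le hε hεa hL hm
  push_cast at h
  exact h

end Summit.AtomisticToContinuum.BoseEinsteinCondensation.Theorems.HardCoreExtension.Negative

end
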